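import Summits.KontsevichZagierPeriods.Zeta5Search.WellPoisedFaceEnvelope
import Summits.KontsevichZagierPeriods.Zeta5Search.WellPoisedFaceConvexity
import HarnessLib

/-!
# ζ(5) search — the face sandwich and the decay rate of Zudilin's `F` (cell `pub-zeta5`, fam-vwp gen 6, file 4)

HONEST FRAMING: systematic search; no irrationality claim unless certified.

Completes OUR boundary lemma (families/vwp/FAMILY.md §14.2) for the numerator-free face of Zudilin's `r = 3`, `q = 7`
box [cite: Zudilin2004, §8 (8.6), (8.7)] IN THE KERNEL: with `faceF = ½ Σ_{t∈ℕ} R″(t)` (file 2, typed verbatim from (8.6))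
and the pointwise facts of file 3 (`0 < R″ ≤ 25h₀²R`, `R(t) ≤ 2h₀³/(t+h₀)³ R(0)`):
* the series converges and `F > 0` (`faceF_summable`, `faceF_pos`);
* SANDWICH: `2 R(0)/h₀² ≤ F ≤ (25π²/6)·h₀⁵·R(0)` (`le_faceF`, `faceF_le`; the lower bound uses `(log R)′(0) ≤ −2/h₀`,
  the upper one `Σ_{t≥0} 1/(t+1)² = π²/6`);
* RATE, unconditional: `tendsto_log_faceF_div : (1/n) log F_n → −Σ_j g(η₀, η_j)` for every integral face direction
  `2η_j < η₀`, `g(η₀,η) = (η₀−η) log(η₀−η) − (η₀−2η) log(η₀−2η) − η log η` — i.e. the true decay rate of the face forms is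
  `C₀ = FaceDir.C0` of `WellPoisedFaceEnvelope.lean`, where `face_noGo` shows `C₀ < δ − φ` at every face direction.
* §10 BRIDGE to file 1: `faceDirOfNat` turns a sorted integral face direction into a `WellPoisedFace.FaceDir`,
  `C0_faceDirOfNat : C0 = Σ_j blockRate η₀ η_j`, and `face_rate_and_noGo` states the kernel part of the face theorem in one line:
  `F_n > 0`, `(1/n) log F_n → −C0`, and `C0 < δ − φ` for every `φ ≤ phiBound = 3m₄` (file 1's `face_noGo`).
What is NOT formalised (and is not ours): Zudilin's Lemma 19 (the forms lie in `ℤζ(5) + ℤ` after the `D`-denominators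
and `Φ⁻¹`) and the prime-number-theorem bookkeeping `(1/n) log D_{M_j} → m_j`.  The constants `2`, `25π²/6`, `h₀⁵` are
crude (paper: `18/h₀²`, `125h₀³`); only polynomial dependence on `h₀` matters for the rate.  Standard axioms only.
-/

noncomputable section

open Real Filter Topology Finset

namespace Summit.KontsevichZagierPeriods.Zeta5Search.WellPoisedFaceRate

/-! ## 9. The sandwich `2R(0)/h₀² ≤ F ≤ (25π²/6)·h₀⁵·R(0)` and the unconditional rate of `F` -/

/-- `Σ_{t ≥ 0} 1/(t+1)²` converges. -/
theorem summable_shift_sq : Summable (fun t : ℕ => 1 / ((t : ℝ) + 1) ^ 2) := by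
  have h := (summable_nat_add_iff 1).mpr (Real.summable_one_div_nat_pow.mpr one_lt_two)
  simpa [Nat.cast_add, Nat.cast_one] using h

/-- `Σ_{t ≥ 0} 1/(t+1)² = π²/6`. -/
theorem hasSum_shift_sq : HasSum (fun t : ℕ => 1 / ((t : ℝ) + 1) ^ 2) (π ^ 2 / 6) := by
  have h := (hasSum_nat_add_iff' 1).mpr hasSum_zeta_two
  simpa [Nat.cast_add, Nat.cast_one] using h

/-- Termwise domination of `R″(t)`, `t ∈ ℕ`, by a summable sequence. -/
theorem iteratedDeriv_two_faceR_le_shift_sq (η₀ : ℕ) (η : Fin 4 → ℕ) (hη : ∀ j, 2 * η j < η₀)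
    (n t : ℕ) :
    iteratedDeriv 2 (faceR η₀ η n) (t : ℝ)
      ≤ 50 * ((η₀ * n + 2 : ℕ) : ℝ) ^ 5 * faceR η₀ η n 0 * (1 / ((t : ℝ) + 1) ^ 2) := by
  set h0 : ℝ := ((η₀ * n + 2 : ℕ) : ℝ) with hh0
  have ht : (0 : ℝ) ≤ t := Nat.cast_nonneg t
  have h0two : 2 ≤ h0 := by rw [hh0]; exact_mod_cast Nat.le_add_left 2 _
  have hR0 : 0 < faceR η₀ η n 0 := faceR_pos η₀ η n (by norm_num)
  have hRt : 0 < faceR η₀ η n t := faceR_pos η₀ η n (by linarith)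
  have h1 := iteratedDeriv_two_faceR_le η₀ η n ht
  have h2 := faceR_decay η₀ η hη n ht
  have h3 : 1 / ((t : ℝ) + h0) ^ 3 ≤ 1 / ((t : ℝ) + 1) ^ 2 := by
    apply one_div_le_one_div_of_le (by positivity)
    have h1' : (1 : ℝ) ≤ t + h0 := by linarith
    nlinarith [mul_le_mul h1' h1' zero_le_one (by linarith), pow_two ((t : ℝ) + h0)]
  calc iteratedDeriv 2 (faceR η₀ η n) (t : ℝ)
      ≤ 25 * h0 ^ 2 * faceR η₀ η n t := h1
    _ ≤ 25 * h0 ^ 2 * (2 * h0 ^ 3 / ((t : ℝ) + h0) ^ 3 * faceR η₀ η n 0) :=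
        mul_le_mul_of_nonneg_left h2 (by positivity)
    _ = 50 * h0 ^ 5 * faceR η₀ η n 0 * (1 / ((t : ℝ) + h0) ^ 3) := by ring
    _ ≤ 50 * h0 ^ 5 * faceR η₀ η n 0 * (1 / ((t : ℝ) + 1) ^ 2) :=
        mul_le_mul_of_nonneg_left h3 (by positivity)

/-- the series (8.6) defining `F` converges (absolutely: positive terms). -/
theorem faceF_summable (η₀ : ℕ) (η : Fin 4 → ℕ) (hη : ∀ j, 2 * η j < η₀) (n : ℕ) :
    Summable (fun t : ℕ => iteratedDeriv 2 (faceR η₀ η n) (t : ℝ)) :=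
  Summable.of_nonneg_of_le
    (fun t => (iteratedDeriv_two_faceR_pos η₀ η hη n (Nat.cast_nonneg t)).le)
    (fun t => iteratedDeriv_two_faceR_le_shift_sq η₀ η hη n t)
    (summable_shift_sq.mul_left _)

/-- `F > 0`: a series of positive terms. -/
theorem faceF_pos (η₀ : ℕ) (η : Fin 4 → ℕ) (hη : ∀ j, 2 * η j < η₀) (n : ℕ) : 0 < faceF η₀ η n := by
  unfold faceF
  have h := (faceF_summable η₀ η hη n).le_tsum 0
    (fun t _ => (iteratedDeriv_two_faceR_pos η₀ η hη n (Nat.cast_nonneg t)).le)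
  have h0 := iteratedDeriv_two_faceR_pos η₀ η hη n (le_refl (0 : ℝ))
  simp only [Nat.cast_zero] at h
  linarith

/-- UPPER half of the sandwich: `F ≤ (25π²/6) · h₀⁵ · R(0)`. -/
theorem faceF_le (η₀ : ℕ) (η : Fin 4 → ℕ) (hη : ∀ j, 2 * η j < η₀) (n : ℕ) :
    faceF η₀ η n ≤ (25 * π ^ 2 / 6) * ((η₀ * n + 2 : ℕ) : ℝ) ^ 5 * faceR0 η₀ η n := by
  unfold faceF
  have hb := (hasSum_shift_sq.mul_left (50 * ((η₀ * n + 2 : ℕ) : ℝ) ^ 5 * faceR η₀ η n 0))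
  have hle := Summable.tsum_le_tsum (fun t => iteratedDeriv_two_faceR_le_shift_sq η₀ η hη n t)
    (faceF_summable η₀ η hη n) hb.summable
  rw [hb.tsum_eq, faceR_zero η₀ η hη n] at hle
  have : (1 / 2 : ℝ) * (50 * ((η₀ * n + 2 : ℕ) : ℝ) ^ 5 * faceR0 η₀ η n * (π ^ 2 / 6))
      = (25 * π ^ 2 / 6) * ((η₀ * n + 2 : ℕ) : ℝ) ^ 5 * faceR0 η₀ η n := by ring
  linarith

/-- `(log R)′(0) ≤ −2/h₀`. -/
theorem dlogR_zero_le (η₀ : ℕ) (η : Fin 4 → ℕ) (hη : ∀ j, 2 * η j < η₀) (n : ℕ) :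
    dlogR η₀ η n 0 ≤ -2 / ((η₀ * n + 2 : ℕ) : ℝ) := by
  set h0 : ℝ := ((η₀ * n + 2 : ℕ) : ℝ) with hh0
  have h0pos : 0 < h0 := by rw [hh0]; positivity
  have hpole0 := pole_pos η n (by norm_num : -1/2 < (0 : ℝ))
  have hh := hj_lt_h0 η₀ η hη n
  have key : ∀ j : Fin 4, 1 / h0 ≤ ∑ i ∈ Finset.range ((η₀ * n + 2) - 2 * (η j * n + 1) + 1),
      1 / ((0 : ℝ) + ((η j * n + 1 : ℕ) : ℝ) + (i : ℝ)) := by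
    intro j
    have h0mem : 0 ∈ Finset.range (((η₀ * n + 2) - 2 * (η j * n + 1)) + 1) := by simp
    have hle := Finset.single_le_sum
      (f := fun i : ℕ => 1 / ((0 : ℝ) + ((η j * n + 1 : ℕ) : ℝ) + (i : ℝ)))
      (fun i _ => (one_div_pos.mpr (hpole0 j i)).le) h0mem
    simp only [Nat.cast_zero, add_zero, zero_add] at hle
    have hjpos : (0 : ℝ) < ((η j * n + 1 : ℕ) : ℝ) := by positivity
    have : 1 / h0 ≤ 1 / ((η j * n + 1 : ℕ) : ℝ) := one_div_le_one_div_of_le hjpos (hh j).le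
    refine this.trans (hle.trans (le_of_eq ?_))
    refine Finset.sum_congr rfl fun i _ => by rw [zero_add]
  have hsum := Finset.sum_le_sum fun j (_ : j ∈ (Finset.univ : Finset (Fin 4))) => key j
  simp only [Finset.sum_const, Finset.card_univ, Fintype.card_fin, nsmul_eq_mul] at hsum
  unfold dlogR
  rw [mul_zero, add_zero]
  have : (2 : ℝ) / h0 - (4 : ℕ) * (1 / h0) = -2 / h0 := by push_cast; ring
  linarith

/-- LOWER half of the sandwich: `2 R(0)/h₀² ≤ F`. -/
theorem le_faceF (η₀ : ℕ) (η : Fin 4 → ℕ) (hη : ∀ j, 2 * η j < η₀) (n : ℕ) :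
    2 * faceR0 η₀ η n / ((η₀ * n + 2 : ℕ) : ℝ) ^ 2 ≤ faceF η₀ η n := by
  set h0 : ℝ := ((η₀ * n + 2 : ℕ) : ℝ) with hh0
  have h0pos : 0 < h0 := by rw [hh0]; positivity
  unfold faceF
  have h := (faceF_summable η₀ η hη n).le_tsum 0
    (fun t _ => (iteratedDeriv_two_faceR_pos η₀ η hη n (Nat.cast_nonneg t)).le)
  simp only [Nat.cast_zero] at h
  rw [iteratedDeriv_two_faceR η₀ η n (by norm_num : -1/2 < (0 : ℝ)), faceR_zero η₀ η hη n] at h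
  have hR0 : 0 < faceR0 η₀ η n := faceR0_pos η₀ η hη n
  have hd2 := d2logR_pos η₀ η hη n (le_refl (0 : ℝ))
  have hd1 := dlogR_zero_le η₀ η hη n
  have hsq : (2 / h0) ^ 2 ≤ dlogR η₀ η n 0 ^ 2 := by
    rw [← neg_sq (dlogR η₀ η n 0)]
    apply pow_le_pow_left₀ (by positivity)
    rw [neg_div] at hd1; linarith
  have : 2 * faceR0 η₀ η n / h0 ^ 2 = (1 / 2 : ℝ) * (faceR0 η₀ η n * ((2 / h0) ^ 2 + 0)) := by
    field_simp; ring
  rw [this]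
  refine le_trans ?_ (mul_le_mul_of_nonneg_left h (by norm_num))
  apply mul_le_mul_of_nonneg_left _ (by norm_num)
  exact mul_le_mul_of_nonneg_left (add_le_add hsq hd2.le) hR0.le

/-- BOUNDARY LEMMA (ii)+(iii), unconditional: the face decay rate
`(1/n) log F_n → −Σ_j [(η₀−η_j) log(η₀−η_j) − (η₀−2η_j) log(η₀−2η_j) − η_j log η_j] = −FaceDir.C0`. -/
theorem tendsto_log_faceF_div (η₀ : ℕ) (η : Fin 4 → ℕ) (hη : ∀ j, 2 * η j < η₀) :
    Tendsto (fun n : ℕ => Real.log (faceF η₀ η n) / n) atTop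
      (𝓝 (-∑ j : Fin 4, (((η₀ : ℝ) - η j) * Real.log ((η₀ : ℝ) - η j)
          - ((η₀ : ℝ) - 2 * η j) * Real.log ((η₀ : ℝ) - 2 * η j) - (η j : ℝ) * Real.log (η j)))) := by
  set C : ℝ := ∑ j : Fin 4, (((η₀ : ℝ) - η j) * Real.log ((η₀ : ℝ) - η j)
      - ((η₀ : ℝ) - 2 * η j) * Real.log ((η₀ : ℝ) - 2 * η j) - (η j : ℝ) * Real.log (η j)) with hC
  set K : ℝ := 25 * π ^ 2 / 6 with hK
  have hKpos : 0 < K := by rw [hK]; positivity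
  have hR : Tendsto (fun n : ℕ => Real.log (faceR0 η₀ η n) / n) atTop (𝓝 (-C)) :=
    tendsto_log_faceR0_div η₀ η hη
  have hh : Tendsto (fun n : ℕ => Real.log ((η₀ * n + 2 : ℕ) : ℝ) / n) atTop (𝓝 0) := by
    have := tendsto_log_linear_div (c := (η₀ : ℝ)) (d := 2) (Nat.cast_nonneg η₀) zero_le_two
    exact this.congr' (Eventually.of_forall fun n => by norm_cast)
  have hc2 : Tendsto (fun n : ℕ => Real.log 2 / (n : ℝ)) atTop (𝓝 0) :=
    tendsto_const_div_atTop_nhds_zero_nat _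
  have hcK : Tendsto (fun n : ℕ => Real.log K / (n : ℝ)) atTop (𝓝 0) :=
    tendsto_const_div_atTop_nhds_zero_nat _
  have hlow : Tendsto (fun n : ℕ => Real.log 2 / n + Real.log (faceR0 η₀ η n) / n
      - 2 * (Real.log ((η₀ * n + 2 : ℕ) : ℝ) / n)) atTop (𝓝 (0 + -C - 2 * 0)) :=
    (hc2.add hR).sub (hh.const_mul 2)
  have hup : Tendsto (fun n : ℕ => Real.log K / n + 5 * (Real.log ((η₀ * n + 2 : ℕ) : ℝ) / n)
      + Real.log (faceR0 η₀ η n) / n) atTop (𝓝 (0 + 5 * 0 + -C)) :=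
    (hcK.add (hh.const_mul 5)).add hR
  rw [mul_zero, sub_zero, zero_add] at hlow
  rw [mul_zero, add_zero, zero_add] at hup
  refine tendsto_of_tendsto_of_tendsto_of_le_of_le' hlow hup ?_ ?_
  · filter_upwards [eventually_gt_atTop 0] with n hpos
    have hR0 : 0 < faceR0 η₀ η n := faceR0_pos η₀ η hη n
    have hh0 : (0 : ℝ) < ((η₀ * n + 2 : ℕ) : ℝ) := by positivity
    have hL : 0 < 2 * faceR0 η₀ η n / ((η₀ * n + 2 : ℕ) : ℝ) ^ 2 := by positivity
    have hn' : (0 : ℝ) < n := by exact_mod_cast hpos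
    have hlog := Real.log_le_log hL (le_faceF η₀ η hη n)
    rw [Real.log_div (by positivity) (by positivity), Real.log_mul (by norm_num) hR0.ne',
      Real.log_pow] at hlog
    push_cast at hlog
    have key : (Real.log 2 + Real.log (faceR0 η₀ η n) - 2 * Real.log ((η₀ * n + 2 : ℕ) : ℝ)) / n
        ≤ Real.log (faceF η₀ η n) / n := div_le_div_of_nonneg_right (by push_cast; linarith) hn'.le
    calc Real.log 2 / n + Real.log (faceR0 η₀ η n) / n - 2 * (Real.log ((η₀ * n + 2 : ℕ) : ℝ) / n)
        = (Real.log 2 + Real.log (faceR0 η₀ η n) - 2 * Real.log ((η₀ * n + 2 : ℕ) : ℝ)) / n := by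
          ring
      _ ≤ Real.log (faceF η₀ η n) / n := key
  · filter_upwards [eventually_gt_atTop 0] with n hpos
    have hR0 : 0 < faceR0 η₀ η n := faceR0_pos η₀ η hη n
    have hh0 : (0 : ℝ) < ((η₀ * n + 2 : ℕ) : ℝ) := by positivity
    have hF : 0 < faceF η₀ η n := faceF_pos η₀ η hη n
    have hn' : (0 : ℝ) < n := by exact_mod_cast hpos
    have hlog := Real.log_le_log hF (faceF_le η₀ η hη n)
    rw [Real.log_mul (by positivity) hR0.ne', Real.log_mul hKpos.ne' (by positivity),
      Real.log_pow] at hlog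
    push_cast at hlog
    have key : Real.log (faceF η₀ η n) / n
        ≤ (Real.log K + 5 * Real.log ((η₀ * n + 2 : ℕ) : ℝ) + Real.log (faceR0 η₀ η n)) / n :=
      div_le_div_of_nonneg_right (by push_cast; linarith) hn'.le
    calc Real.log (faceF η₀ η n) / n
        ≤ (Real.log K + 5 * Real.log ((η₀ * n + 2 : ℕ) : ℝ) + Real.log (faceR0 η₀ η n)) / n := key
      _ = Real.log K / n + 5 * (Real.log ((η₀ * n + 2 : ℕ) : ℝ) / n)
          + Real.log (faceR0 η₀ η n) / n := by ring


/-! ### §10 Bridge to `WellPoisedFaceEnvelope.lean`: the rate IS `FaceDir.C0`; the kernel part of the face theorem in one line -/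

open Summit.KontsevichZagierPeriods.Zeta5Search.WellPoisedFace (FaceDir blockRate)

/-- A sorted integral face direction `(η₀; 0,0,0, η 0, η 1, η 2, η 3)`, `2·η 3 < η₀`, as a real `FaceDir` of file 1. -/
def faceDirOfNat (η₀ : ℕ) (η : Fin 4 → ℕ) (h01 : η 0 ≤ η 1) (h12 : η 1 ≤ η 2) (h23 : η 2 ≤ η 3)
    (h3 : 2 * η 3 < η₀) : FaceDir where
  η₀ := η₀
  a := η 0
  b := η 1
  c := η 2
  d := η 3
  ha := Nat.cast_nonneg _
  hab := by exact_mod_cast h01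
  hbc := by exact_mod_cast h12
  hcd := by exact_mod_cast h23
  hd := by exact_mod_cast h3

/-- `C0` of the associated `FaceDir` is the sum of the four block rates at `(η₀, η_j)`. -/
theorem C0_faceDirOfNat (η₀ : ℕ) (η : Fin 4 → ℕ) (h01 : η 0 ≤ η 1) (h12 : η 1 ≤ η 2) (h23 : η 2 ≤ η 3)
    (h3 : 2 * η 3 < η₀) :
    (faceDirOfNat η₀ η h01 h12 h23 h3).C0 = ∑ j : Fin 4, blockRate η₀ (η j) := by
  simp [FaceDir.C0, faceDirOfNat, Fin.sum_univ_four]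

/-- A sorted face direction satisfies `2η_j < η₀` for every colour. -/
theorem two_mul_lt_of_sorted (η₀ : ℕ) (η : Fin 4 → ℕ) (h01 : η 0 ≤ η 1) (h12 : η 1 ≤ η 2) (h23 : η 2 ≤ η 3)
    (h3 : 2 * η 3 < η₀) : ∀ j, 2 * η j < η₀ := by
  intro j; fin_cases j <;> simp <;> omega

/-- THE KERNEL PART OF THE FACE THEOREM in one statement: for every sorted integral face direction of Zudilin's
`r = 3`, `q = 7` box, (1) Zudilin's `F_n = ½ Σ_t R_n″(t)` is positive and `(1/n) log F_n → −C₀` with `C₀ = FaceDir.C0`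
(this file), and (2) `C₀ < δ − φ` for every `φ ≤ 3m₄` (`face_noGo`, file 1) — so, granted Lemma 19 and the PNT
bookkeeping `(1/n) log D_{m_j n} → m_j`, `lim sup (1/n) log Φ ≤ 3m₄`, the Lemma-19 forms grow exponentially and
Proposition 5 never applies on the face.  Systematic search; no irrationality claim. -/
theorem face_rate_and_noGo (η₀ : ℕ) (η : Fin 4 → ℕ) (h01 : η 0 ≤ η 1) (h12 : η 1 ≤ η 2) (h23 : η 2 ≤ η 3)
    (h3 : 2 * η 3 < η₀) (φ : ℝ) (hφ : φ ≤ (faceDirOfNat η₀ η h01 h12 h23 h3).phiBound) :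
    (∀ n, 0 < faceF η₀ η n) ∧
    Tendsto (fun n : ℕ => Real.log (faceF η₀ η n) / n) atTop (𝓝 (-(faceDirOfNat η₀ η h01 h12 h23 h3).C0)) ∧
    (faceDirOfNat η₀ η h01 h12 h23 h3).C0 < (faceDirOfNat η₀ η h01 h12 h23 h3).delta - φ := by
  have hη := two_mul_lt_of_sorted η₀ η h01 h12 h23 h3
  refine ⟨faceF_pos η₀ η hη, ?_, (faceDirOfNat η₀ η h01 h12 h23 h3).face_noGo φ hφ⟩
  rw [C0_faceDirOfNat]
  exact tendsto_log_faceF_div η₀ η hη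

end Summit.KontsevichZagierPeriods.Zeta5Search.WellPoisedFaceRate
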